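import Summits.Ventures.PercRepro.Night2OneFatTargets
import Summits.Ventures.PercRepro.Night2OneFatLoad
import Summits.Ventures.PercRepro.Night2OneFatSources

/-!
# PercRepro — the column bound of the good-target rule at a coloop-free target (night-2, gen 29)

In the cell `(2, 1)` with at most one fat closure, a shadow set `S` whose `S ∖ K` has no coloops receives load only
from sources `y ∈ S` whose erasure `S ∖ y` has a lossy big face, each sending at most its total loss `≤ 53/360`
(`faceLoss_sum_le_one_fat`); the fallback (missed-point) shares never reach a coloop-free target (a missed point of
`Q` that is not good lies in the closures of two faces, whose coloops stay coloops of `S ∖ K`); and the sources are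
among the four points `C₀ ∪ {y₀}` of a first source (`mem_coloops_of_source`).  Hence
`dload S ≤ 4 · 53/360 = 53/90 < 11/18 ≤ capS S = cap2 S` (no thin covering preimage at all).

* `faceLossP_structure`: what a nonzero `P`-face loss gives; `sum_faceLossP_le_one_fat`: `Σ_w faceLossP Q w ≤ 53/360`;
* `mem_coloops_insert_of_mem_clF`: a coloop `w` of `Q ∖ K` with `y ∈ cl (Q ∖ w)` is a coloop of `(Q ∪ {y}) ∖ K`;
* `gtLoadAt_eq_zero_of_fallback_no_coloops`, `gtLoadAt_le_of_no_coloops`;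
* **`dload_gt_le_cap2_of_no_coloops`**: THE COLUMN BOUND AT A COLOOP-FREE TARGET.
-/

namespace PercRepro.Shadow

open Finset PerFlat ThmH

variable {α : Type*} [DecidableEq α] {M : Matroid α} [M.Finite] {G : Finset α}

section ColumnZero

/-- The big members. -/
abbrev bigP (M : Matroid α) [M.Finite] (G : Finset α) : Finset α → Prop := fun B => 5 ≤ (B \ coloops M G).card

open scoped Classical in
/-- A nonzero `P`-face loss of `Q` at `w`: the face is a thin big member missing `w`, with nonzero loss. -/
theorem faceLossP_structure {Q : Finset α} {w : α} (h : faceLossP M 5 G (bigP M G) Q w ≠ 0) :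
    Q.erase w ∈ thinMembers M 5 G ∧ 5 ≤ (Q.erase w \ coloops M G).card ∧ w ∈ G \ clF M (Q.erase w) ∧
      loss M 5 G (Q.erase w) w ≠ 0 := by
  unfold faceLossP at h
  by_cases hc : Q.erase w ∈ thinMembers M 5 G ∧ bigP M G (Q.erase w) ∧ w ∈ G \ clF M (Q.erase w)
  · rw [if_pos hc] at h
    exact ⟨hc.1, hc.2.1, hc.2.2, h⟩
  · rw [if_neg hc] at h
    exact absurd rfl h

open scoped Classical in
/-- **`Σ_{w ∈ Q} faceLossP Q w ≤ 53/360`** (cell `(2, 1)`, at most one fat closure) when `Q` has a lossy big face. -/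
theorem sum_faceLossP_le_one_fat (hG : G ∈ flatsQ M (5 + 1)) (hd : (gr M \ G).card = 2)
    (hk : kColoops M G = 1) (hs : ∀ e ∈ gr M, ∀ f ∈ gr M, e ≠ f → rkN M {e, f} = 2)
    (hl : ∀ e ∈ gr M, M.Indep {e}) (hfat : (fatClosures M 5 G 2).card ≤ 1) {Q : Finset α} {w₀ : α}
    (hw₀ : w₀ ∈ Q) (h0 : faceLossP M 5 G (bigP M G) Q w₀ ≠ 0) :
    ∑ w ∈ Q, faceLossP M 5 G (bigP M G) Q w ≤ 53 / 360 := by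
  have hd' : (gr M \ G).card ≤ 5 := by omega
  obtain ⟨hthin, hbig, hw₀cl, -⟩ := faceLossP_structure h0
  -- `|Q ∖ K| ≥ 6`, so every face is big
  have hw₀K : w₀ ∉ coloops M G := fun h => (Finset.notMem_erase w₀ Q) (coloops_subset_of_mem_thinMembers hG hd' hthin h)
  have hQ6 : 6 ≤ (Q \ coloops M G).card := by
    have h1 : Q \ coloops M G = insert w₀ (Q.erase w₀ \ coloops M G) := by
      rw [← Finset.insert_sdiff_of_notMem _ hw₀K, Finset.insert_erase hw₀]
    rw [h1, Finset.card_insert_of_notMem (fun h => (Finset.notMem_erase w₀ Q) (Finset.mem_sdiff.1 h).1)]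
    omega
  have hbigall : ∀ w ∈ Q, Q.erase w ∈ thinMembers M 5 G → w ∈ G \ clF M (Q.erase w) →
      loss M 5 G (Q.erase w) w ≠ 0 → 5 ≤ (Q.erase w \ coloops M G).card := by
    intro w hw hthin' _ _
    have hwK : w ∉ coloops M G := fun h => (Finset.notMem_erase w Q) (coloops_subset_of_mem_thinMembers hG hd' hthin' h)
    have h1 : Q \ coloops M G = insert w (Q.erase w \ coloops M G) := by
      rw [← Finset.insert_sdiff_of_notMem _ hwK, Finset.insert_erase hw]
    rw [h1, Finset.card_insert_of_notMem (fun h => (Finset.notMem_erase w Q) (Finset.mem_sdiff.1 h).1)] at hQ6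
    omega
  have hF := faceLoss_sum_le_one_fat hG hd hk hs hl hfat Q hbigall
  -- the `P`-face losses vanish at the coloops of `G`
  have hzeroK : ∀ w ∈ Q, w ∈ coloops M G → faceLossP M 5 G (bigP M G) Q w = 0 := by
    intro w _ hwK
    unfold faceLossP
    rw [if_neg]
    rintro ⟨hthin', -, -⟩
    exact (Finset.notMem_erase w Q) (coloops_subset_of_mem_thinMembers hG hd' hthin' hwK)
  have hsum : ∑ w ∈ Q, faceLossP M 5 G (bigP M G) Q w = ∑ w ∈ Q \ coloops M G, faceLossP M 5 G (bigP M G) Q w := by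
    symm
    apply Finset.sum_subset Finset.sdiff_subset
    intro w hw hwn
    exact hzeroK w hw (by by_contra h; exact hwn (Finset.mem_sdiff.2 ⟨hw, h⟩))
  rw [hsum]
  calc ∑ w ∈ Q \ coloops M G, faceLossP M 5 G (bigP M G) Q w
      ≤ ∑ w ∈ Q \ coloops M G, faceLoss M 5 G Q w :=
        Finset.sum_le_sum (fun w _ => faceLossP_le_faceLoss (P := bigP M G) hG hd' Q w)
    _ ≤ 53 / 360 := hF

open scoped Classical in
/-- The structure of `Q` from a nonzero `P`-face loss: `Q ⊆ G`, `rk (Q ∖ K) = 5`, three coloops, the thin faces are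
the faces at the coloops, the rest has rank `2` and `≥ 3` points. -/
theorem lossy_structure_of_faceLossP_ne_zero (hG : G ∈ flatsQ M (5 + 1)) (hd : (gr M \ G).card = 2)
    (hk : kColoops M G = 1) (hs : ∀ e ∈ gr M, ∀ f ∈ gr M, e ≠ f → rkN M {e, f} = 2)
    (hl : ∀ e ∈ gr M, M.Indep {e}) {Q : Finset α} {w₀ : α} (hw₀ : w₀ ∈ Q)
    (h0 : faceLossP M 5 G (bigP M G) Q w₀ ≠ 0) :
    Q ⊆ G ∧ rkN M (Q \ coloops M G) = 5 ∧ (coloops M (Q \ coloops M G)).card = 3 ∧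
      thinFacesOf M 5 G Q = (coloops M (Q \ coloops M G)).image (fun w => Q.erase w) ∧
      rkN M ((Q \ coloops M G) \ coloops M (Q \ coloops M G)) = 2 ∧
      3 ≤ ((Q \ coloops M G) \ coloops M (Q \ coloops M G)).card := by
  obtain ⟨hthin, hbig, hw₀cl, hl0⟩ := faceLossP_structure h0
  have hQeq : insert w₀ (Q.erase w₀) = Q := Finset.insert_erase hw₀
  have h := three_thin_faces_of_loss_ne_zero hG hd hk hs hl hthin hbig hw₀cl hl0
  rw [hQeq] at h
  have hQ5 := rkN_insert_sdiff_coloops_eq_five_of_thin hG hd hk hthin hw₀cl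
  rw [hQeq] at hQ5
  have hQG : Q ⊆ G := by
    rw [← hQeq]
    exact Finset.insert_subset (Finset.mem_sdiff.1 hw₀cl).1
      ((subset_clF (mem_membersIn.1 (mem_thinMembers.1 hthin).1).1).trans
        (mem_membersIn.1 (mem_thinMembers.1 hthin).1).2)
  exact ⟨hQG, hQ5, h.1, h.2.1, h.2.2.1, h.2.2.2⟩

/-- **A coloop `w` of `Q ∖ K` with `y ∈ cl (Q ∖ w)` is a coloop of `(Q ∪ {y}) ∖ K`** (`Q ⊆ G`, `y ∈ G ∖ K`,
`Q ∖ w` a thin member, `rk (Q ∖ K) = 5`). -/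
theorem mem_coloops_insert_of_mem_clF (hG : G ∈ flatsQ M (5 + 1)) (hd : (gr M \ G).card = 2)
    (hk : kColoops M G = 1) {Q : Finset α} (hQG : Q ⊆ G) (hQ5 : rkN M (Q \ coloops M G) = 5) {w : α}
    (hw : w ∈ coloops M (Q \ coloops M G)) (hthin : Q.erase w ∈ thinMembers M 5 G) {y : α}
    (hy : y ∈ G \ coloops M G) (hyQ : y ∉ Q) (hycl : y ∈ clF M (Q.erase w)) :
    w ∈ coloops M (insert y Q \ coloops M G) := by
  have hd' : (gr M \ G).card ≤ 5 := by omega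
  have hGg : G ⊆ gr M := (mem_flatsQ.1 hG).1
  have hyK : y ∉ coloops M G := (Finset.mem_sdiff.1 hy).2
  have hwQK : w ∈ Q \ coloops M G := (mem_coloops.1 hw).1
  have hwK : w ∉ coloops M G := (Finset.mem_sdiff.1 hwQK).2
  have hS : insert y Q \ coloops M G = insert y (Q \ coloops M G) := Finset.insert_sdiff_of_notMem _ hyK
  rw [hS, mem_coloops]
  refine ⟨Finset.mem_insert_of_mem hwQK, fun hwcl => ?_⟩
  -- the coloop of `G`
  have hcard1 : (coloops M G).card = 1 := by rw [← kColoops_eq_card_coloops (M := M) G]; exact hk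
  obtain ⟨e₀, he₀⟩ := Finset.card_eq_one.1 hcard1
  have he₀c : e₀ ∈ coloops M G := by rw [he₀]; exact Finset.mem_singleton_self _
  have he₀G : e₀ ∈ G := (mem_coloops.1 he₀c).1
  have he₀cl : e₀ ∉ clF M (G.erase e₀) := (mem_coloops.1 he₀c).2
  have hKQ : coloops M G ⊆ Q.erase w := coloops_subset_of_mem_thinMembers hG hd' hthin
  have he₀Q : e₀ ∈ Q.erase w := hKQ he₀c
  -- `Q ∖ w = insert e₀ ((Q ∖ K) ∖ w)`
  have hface : Q.erase w = insert e₀ ((Q \ coloops M G).erase w) := by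
    ext a
    simp only [Finset.mem_erase, Finset.mem_insert, Finset.mem_sdiff, he₀, Finset.mem_singleton]
    constructor
    · rintro ⟨haw, haQ⟩
      by_cases hae : a = e₀
      · exact Or.inl hae
      · exact Or.inr ⟨haw, haQ, hae⟩
    · rintro (rfl | ⟨haw, haQ, -⟩)
      · exact Finset.mem_erase.1 he₀Q
      · exact ⟨haw, haQ⟩
  -- ranks: `rk (Q ∖ w) = 5`, `rk ((Q ∖ K) ∖ w) = 4`
  have hr5 : rkN M (Q.erase w) = 5 := rkN_eq_five_of_mem_thinMembers hthin
  have hr4 : rkN M ((Q \ coloops M G).erase w) = 4 := by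
    have := rkN_erase_of_mem_coloops (M := M) (Finset.sdiff_subset.trans (hQG.trans hGg)) hw
    omega
  -- `y ∈ cl ((Q ∖ K) ∖ w)`: else adding `y` gives rank `5` and then `e₀` adds one more, against `rk (insert y (Q ∖ w)) = 5`
  have hsubV : (Q \ coloops M G).erase w ⊆ G.erase e₀ := by
    intro a ha
    rw [Finset.mem_erase, Finset.mem_sdiff] at ha
    rw [Finset.mem_erase]
    exact ⟨fun h => ha.2.2 (h ▸ he₀c), hQG ha.2.1⟩
  have hycl' : y ∈ clF M ((Q \ coloops M G).erase w) := by
    by_contra hyn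
    have h1 := rkN_insert_of_notMem_clF (M := M) (hGg (Finset.mem_sdiff.1 hy).1) hyn
    rw [hr4] at h1
    have hyG : y ∈ G.erase e₀ := Finset.mem_erase.2 ⟨fun h => hyK (h ▸ he₀c), (Finset.mem_sdiff.1 hy).1⟩
    have he₀n : e₀ ∉ clF M (insert y ((Q \ coloops M G).erase w)) :=
      fun h => he₀cl (clF_mono (Finset.insert_subset hyG hsubV) h)
    have h2 := rkN_insert_of_notMem_clF (M := M) (hGg he₀G) he₀n
    rw [h1] at h2
    have h3 : rkN M (insert y (Q.erase w)) ≤ rkN M (Q.erase w) :=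
      rkN_insert_le_of_mem_clF (M := M) ((Finset.erase_subset _ _).trans (hQG.trans hGg)) hycl
    have heq : insert e₀ (insert y ((Q \ coloops M G).erase w)) = insert y (Q.erase w) := by
      rw [hface, Finset.insert_comm]
    rw [heq] at h2
    rw [hr5] at h3
    omega
  -- so `rk (insert y ((Q ∖ K) ∖ w)) = 4`, and `w ∈ cl` of it gives `rk (insert y (Q ∖ K)) ≤ 4 < 5`
  have h4 : rkN M (insert y ((Q \ coloops M G).erase w)) ≤ 4 := by
    have := rkN_insert_le_of_mem_clF (M := M) ((Finset.erase_subset _ _).trans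
      (Finset.sdiff_subset.trans (hQG.trans hGg))) hycl'
    omega
  have heq2 : (insert y (Q \ coloops M G)).erase w = insert y ((Q \ coloops M G).erase w) := by
    rw [Finset.erase_insert_of_ne (by rintro rfl; exact hyQ (Finset.mem_sdiff.1 hwQK).1)]
  rw [heq2] at hwcl
  have h5 := rkN_insert_le_of_mem_clF (M := M) (Finset.insert_subset (hGg (Finset.mem_sdiff.1 hy).1)
    ((Finset.erase_subset _ _).trans (Finset.sdiff_subset.trans (hQG.trans hGg)))) hwcl
  have hins : insert w (insert y ((Q \ coloops M G).erase w)) = insert y (Q \ coloops M G) := by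
    rw [Finset.insert_comm, Finset.insert_erase hwQK]
  rw [hins] at h5
  have h6 : 5 ≤ rkN M (insert y (Q \ coloops M G)) := by
    rw [← hQ5]; exact rkN_mono (Finset.subset_insert _ _)
  omega

open scoped Classical in
/-- At a coloop-free target the fallback shares vanish: a missed point of a lossy `Q` that is not good lies in two face
closures, whose coloops are coloops of `S ∖ K`. -/
theorem gtLoadAt_le_of_no_coloops (hG : G ∈ flatsQ M (5 + 1)) (hd : (gr M \ G).card = 2)
    (hk : kColoops M G = 1) (hs : ∀ e ∈ gr M, ∀ f ∈ gr M, e ≠ f → rkN M {e, f} = 2)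
    (hl : ∀ e ∈ gr M, M.Indep {e}) (hfat : (fatClosures M 5 G 2).card ≤ 1) {S : Finset α} (hSG : S ⊆ G)
    (hc : coloops M (S \ coloops M G) = ∅) {y : α} (hy : y ∈ S) :
    gtLoadAt M 5 G (bigP M G) (S.erase y) y ≤
      if ∃ w ∈ S.erase y, faceLossP M 5 G (bigP M G) (S.erase y) w ≠ 0 then 53 / 360 else 0 := by
  have hd' : (gr M \ G).card ≤ 5 := by omega
  set Q := S.erase y with hQ
  have hnn : ∀ w, 0 ≤ faceLossP M 5 G (bigP M G) Q w := fun w => faceLossP_nonneg hG hd' Q w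
  by_cases hex : ∃ w ∈ Q, faceLossP M 5 G (bigP M G) Q w ≠ 0
  · rw [if_pos hex]
    obtain ⟨w₀, hw₀, h0⟩ := hex
    have hsum := sum_faceLossP_le_one_fat hG hd hk hs hl hfat hw₀ h0
    have hsum0 : 0 ≤ ∑ w ∈ Q, faceLossP M 5 G (bigP M G) Q w := Finset.sum_nonneg (fun w _ => hnn w)
    unfold gtLoadAt
    by_cases hne : (gtPts M 5 G Q).Nonempty
    · rw [if_pos hne]
      split_ifs with hyg
      · have hpos : (1 : ℚ) ≤ ((gtPts M 5 G Q).card : ℚ) := by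
          exact_mod_cast Finset.card_pos.2 hne
        calc (∑ w ∈ Q, faceLossP M 5 G (bigP M G) Q w) / ((gtPts M 5 G Q).card : ℚ)
            ≤ (∑ w ∈ Q, faceLossP M 5 G (bigP M G) Q w) / 1 := by
              apply div_le_div_of_nonneg_left hsum0 (by norm_num) hpos
          _ ≤ 53 / 360 := by rw [div_one]; exact hsum
      · norm_num
    · -- the fallback: `y` is not good, so two coloops of `Q ∖ K` are coloops of `S ∖ K`
      exfalso
      obtain ⟨hQG, hQ5, hC3, hImg, -, -⟩ := lossy_structure_of_faceLossP_ne_zero hG hd hk hs hl hw₀ h0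
      have hyQ : y ∉ Q := Finset.notMem_erase y S
      have hyG : y ∈ G \ Q := Finset.mem_sdiff.2 ⟨hSG hy, hyQ⟩
      have hyK : y ∉ coloops M G := by
        intro h
        obtain ⟨hthin, -, -, -⟩ := faceLossP_structure h0
        exact hyQ ((Finset.erase_subset _ _) (coloops_subset_of_mem_thinMembers hG hd' hthin h))
      have hyV : y ∈ G \ coloops M G := Finset.mem_sdiff.2 ⟨hSG hy, hyK⟩
      have hnotgood : ¬ ((thinFacesOf M 5 G Q).filter (fun F => y ∈ clF M F)).card ≤ 1 := by
        intro h1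
        exact hne ⟨y, mem_goodPts.2 ⟨hyG, h1⟩⟩
      push Not at hnotgood
      rw [hImg] at hnotgood
      -- two faces `Q ∖ w₁ ≠ Q ∖ w₂` at coloops with `y` in their closures
      obtain ⟨F₁, hF₁, F₂, hF₂, hF12⟩ := Finset.one_lt_card.1 hnotgood
      rw [Finset.mem_filter, Finset.mem_image] at hF₁ hF₂
      obtain ⟨⟨w₁, hw₁, rfl⟩, hy₁⟩ := hF₁
      obtain ⟨⟨w₂, hw₂, rfl⟩, hy₂⟩ := hF₂
      have hw12 : w₁ ≠ w₂ := fun h => hF12 (by rw [h])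
      have hthin₁ : Q.erase w₁ ∈ thinMembers M 5 G := by
        have : Q.erase w₁ ∈ thinFacesOf M 5 G Q := by
          rw [hImg, Finset.mem_image]; exact ⟨w₁, hw₁, rfl⟩
        unfold thinFacesOf at this
        rw [Finset.mem_filter, mem_coverPreimages] at this
        exact mem_thinMembers.2 ⟨this.1.1, this.2⟩
      have hthin₂ : Q.erase w₂ ∈ thinMembers M 5 G := by
        have : Q.erase w₂ ∈ thinFacesOf M 5 G Q := by
          rw [hImg, Finset.mem_image]; exact ⟨w₂, hw₂, rfl⟩
        unfold thinFacesOf at this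
        rw [Finset.mem_filter, mem_coverPreimages] at this
        exact mem_thinMembers.2 ⟨this.1.1, this.2⟩
      have hc₁ := mem_coloops_insert_of_mem_clF hG hd hk hQG hQ5 hw₁ hthin₁ hyV hyQ hy₁
      have hSeq : insert y Q = S := Finset.insert_erase hy
      rw [hSeq, hc] at hc₁
      exact Finset.notMem_empty _ hc₁
  · rw [if_neg hex]
    push Not at hex
    unfold gtLoadAt
    have hzero : ∑ w ∈ Q, faceLossP M 5 G (bigP M G) Q w = 0 := Finset.sum_eq_zero hex
    split_ifs
    · rw [hzero, zero_div]
    · exact le_refl _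
    · apply le_of_eq
      apply Finset.sum_eq_zero
      intro w hw
      rw [hex w hw]
      simp

open scoped Classical in
/-- **THE COLUMN BOUND AT A COLOOP-FREE TARGET** (cell `(2, 1)`, at most one fat closure, `P` = the big members,
the good-target shares): `dload S ≤ 53/90 < 11/18 ≤ cap2 S`. -/
theorem dload_gt_le_cap2_of_no_coloops (hG : G ∈ flatsQ M (5 + 1)) (hd : (gr M \ G).card = 2)
    (hk : kColoops M G = 1) (hs : ∀ e ∈ gr M, ∀ f ∈ gr M, e ≠ f → rkN M {e, f} = 2)
    (hl : ∀ e ∈ gr M, M.Indep {e}) (hfat : (fatClosures M 5 G 2).card ≤ 1) {S : Finset α} (hSG : S ⊆ G)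
    (hc : coloops M (S \ coloops M G) = ∅) :
    dload M 5 G (bigP M G) (dshGT M 5 G) S ≤ cap2 M 5 G S := by
  have hd' : (gr M \ G).card ≤ 5 := by omega
  have hGg : G ⊆ gr M := (mem_flatsQ.1 hG).1
  -- the sources
  set Src := S.filter (fun y => ∃ w ∈ S.erase y, faceLossP M 5 G (bigP M G) (S.erase y) w ≠ 0) with hSrc
  have h1 := dload_gt_le_sum (P := bigP M G) hG hd' S
  have h2 : ∑ y ∈ S, gtLoadAt M 5 G (bigP M G) (S.erase y) y ≤ (Src.card : ℚ) * (53 / 360) := by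
    calc ∑ y ∈ S, gtLoadAt M 5 G (bigP M G) (S.erase y) y
        ≤ ∑ y ∈ S, (if ∃ w ∈ S.erase y, faceLossP M 5 G (bigP M G) (S.erase y) w ≠ 0 then (53 / 360 : ℚ) else 0) :=
          Finset.sum_le_sum (fun y hy => gtLoadAt_le_of_no_coloops hG hd hk hs hl hfat hSG hc hy)
      _ = ∑ y ∈ Src, (53 / 360 : ℚ) := by rw [Finset.sum_filter]
      _ = (Src.card : ℚ) * (53 / 360) := by rw [Finset.sum_const, nsmul_eq_mul]
  -- at most four sources
  have h3 : Src.card ≤ 4 := by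
    by_cases hSrc0 : Src = ∅
    · rw [hSrc0]; simp
    · obtain ⟨y₀, hy₀⟩ := Finset.nonempty_iff_ne_empty.2 hSrc0
      have hy₀' := Finset.mem_filter.1 hy₀
      obtain ⟨w₀, hw₀, h0⟩ := hy₀'.2
      obtain ⟨hQ₀G, hQ₀5, hC₀, -, hR₀, hR₀3⟩ := lossy_structure_of_faceLossP_ne_zero hG hd hk hs hl hw₀ h0
      have hS5 : rkN M (S \ coloops M G) = 5 := by
        have ha : rkN M (S.erase y₀ \ coloops M G) ≤ rkN M (S \ coloops M G) :=
          rkN_mono (Finset.sdiff_subset_sdiff (Finset.erase_subset _ _) (Finset.Subset.refl _))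
        have hb : rkN M (S \ coloops M G) ≤ rkN M (G \ coloops M G) :=
          rkN_mono (Finset.sdiff_subset_sdiff hSG (Finset.Subset.refl _))
        rw [rkN_sdiff_coloops_eq_five hG hk] at hb
        omega
      have hsub : Src ⊆ insert y₀ (coloops M (S.erase y₀ \ coloops M G)) := by
        intro y hy
        rw [Finset.mem_insert]
        by_cases hyy : y = y₀
        · exact Or.inl hyy
        · right
          have hy' := Finset.mem_filter.1 hy
          obtain ⟨w, hw, hw0⟩ := hy'.2
          obtain ⟨-, -, hC, -, hR, -⟩ := lossy_structure_of_faceLossP_ne_zero hG hd hk hs hl hw hw0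
          exact mem_coloops_of_source hG hs hSG hS5 hc hy₀'.1 hy'.1 hyy hC₀ hR₀ hR₀3 hC hR
      have := Finset.card_le_card hsub
      have h4 := Finset.card_insert_le y₀ (coloops M (S.erase y₀ \ coloops M G))
      omega
  -- the capacity: no thin covering preimage, `L1 S = 0`
  have hL1 : L1 M 5 G S = 0 := by
    unfold L1
    apply Finset.sum_eq_zero
    intro F hF
    have := thin_coverPreimages_subset_image_coloops hG hd' S hF
    rw [hc, Finset.image_empty] at this
    exact absurd this (Finset.notMem_empty _)
  have hcap := capS_ge_eleven_eighteenths_two_one hd hk hSG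
  have hcap2 := cap2_ge_capS_sub_L1_of_le hG hd' S
  have hc4 : (Src.card : ℚ) ≤ 4 := by exact_mod_cast h3
  rw [hL1] at hcap2
  nlinarith

end ColumnZero

end PercRepro.Shadow
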